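import Literature.MathematicalPhysics.QuantumFieldTheory.Balaban1983to89.B11SectG

/-!
# `Balaban1983to89.B9BlockNormClassTransfer` — [Balaban1984PropagatorsII] (2.51)–(2.52) p. 232, [Balaban1985BackgroundPropagators] (3.39)–(3.41), (3.44) pp. 397–398:
# TRANSFER OF A BLOCK MAJORANT FROM A FINELY LOCALISED SOURCE NORM TO A COARSELY (CLASS-) LOCALISED ONE, AT THE COST OF THE CLASS MULTIPLICITY

statement-level skeleton of published theorems with citation tags; proofs where landed; nothing here is a claim about the Yang–Mills mass gap

WHY THIS FILE (located «INPUT-LOC CLASS≠FIBRE», dag-n06-w3 g2 ∕ dag-n06-d g9, 2026-08-28).  In `B11SectG`'s vocabulary a majorant `HasMaj b₁ b₂ T K` is tested on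
source functions `μ` LOCALISED in the sense of the source norm `b₁` (`b₁.IsLoc y′ μ`).  Two localisation notions meet in the N06 certificate: the walk letters'
sup classes `BlockNorm.ofBlocks … blk` (localised = vanishing off ONE FIBRE `blk⁻¹ y′` of the index-bond map) and the input norm of print's (3.44)
(`B9CoReadingCoordsInput.bHK`: localised = vanishing off the CARRIER CLASS of `y′` — print's `supp λ ⊂ Δ̃(y′)`, a block that carries up to `2(d+1)` index
bonds, `B9CarrierBlockMultiplicity`).  `B9Thm313WholeInput.hasMaj_of_dom` transfers a majorant from `b₁` to a dominating norm `b₁′` under the hypothesis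
`b₁′.IsLoc y μ → b₁.IsLoc y μ` — class ⊆ fibre, FALSE whenever a class holds two fibres.  THE TRUE TRANSFER splits a class-localised `μ` into its `b₁`-pieces
(`b₁.sum_cut`), applies the `b₁`-majorant to each piece, and sums: the kernel picks up the class multiplicity `m` (print: the block sums of [4] (2.52)).

## WHAT IS PROVED (sorry-free, standard axioms; pure `BlockNorm` algebra)

* ★★ `hasMaj_of_dom_classes` — from `HasMaj b₁ b₂ T K`: if the `b₁`-pieces of every `b₁′`-localised `μ` vanish outside the class of `y′` (`hvanish`), each
  piece inside the class has `b₁`-size `≤ b₁′.loc y′ μ` (`hle`), the kernel is non-negative and does not increase inside a class (`hKrel`), and classes have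
  at most `m` members (`hmult`), then `HasMaj b₁′ b₂ T (m·K)`.
* `hasMaj_of_dom_classes_eq` — the same with a class-CONSTANT kernel (`K a b′ = K a b` inside a class; e.g. kernels of the carrier distance).

HONEST FRAMING.  Finite bookkeeping; nothing of [B9] asserted; COUNT-NEUTRAL; N06 NOT discharged; nothing continuum ∕ OS ∕ mass-gap ∕ Clay.  Cell `pub-ymgap`
(D-0062), node N06 [B9], seat `pub-ymgap-dag-n06-d` (gen 9).  A NEW file.
-/

namespace Literature.MathematicalPhysics.QuantumFieldTheory.Balaban1983to89.B9BlockNormClassTransfer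

open B11SectG (BlockNorm HasMaj)

variable {g : B6.Geometry}
variable {F₁ F₂ : Type} [AddCommGroup F₁] [Module ℝ F₁] [AddCommGroup F₂] [Module ℝ F₂]

/-- ★★ **CLASS-MULTIPLICITY TRANSFER OF A BLOCK MAJORANT**: `HasMaj b₁ b₂ T K` with `K ≥ 0` non-increasing inside the classes of a relation `Rel`, classes of
cardinality `≤ m`, and a second source norm `b₁′` whose localised functions have vanishing `b₁`-pieces outside the class and `b₁`-pieces of size `≤ b₁′.loc`
inside it, gives `HasMaj b₁′ b₂ T (m·K)`. [cite: Balaban1984PropagatorsII, (2.51)–(2.52) p.232; Balaban1985BackgroundPropagators, (3.44) p.398 («supp λ ⊂ Δ(y′)»)] -/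
theorem hasMaj_of_dom_classes {b₁ b₁' : BlockNorm g F₁} {b₂ : BlockNorm g F₂} {T : F₁ →ₗ[ℝ] F₂} {K : g.Site → g.Site → ℝ}
    (Rel : g.Site → g.Site → Prop) [DecidableRel Rel] {m : ℝ}
    (hvanish : ∀ (y' : g.Site) (μ : F₁), b₁'.IsLoc y' μ → ∀ y'' : g.Site, ¬ Rel y'' y' → b₁.cut y'' μ = 0)
    (hle : ∀ (y' : g.Site) (μ : F₁), b₁'.IsLoc y' μ → ∀ y'' : g.Site, Rel y'' y' → b₁.loc y'' (b₁.cut y'' μ) ≤ b₁'.loc y' μ)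
    (hK : ∀ a b, 0 ≤ K a b) (hKrel : ∀ a b b', Rel b' b → K a b' ≤ K a b)
    (hmult : ∀ y' : g.Site, ((Finset.univ.filter (fun y'' => Rel y'' y')).card : ℝ) ≤ m)
    (h : HasMaj b₁ b₂ T K) : HasMaj b₁' b₂ T (fun a b => m * K a b) := by
  classical
  intro y' μ hμ y
  have hsplit : T μ = ∑ y'' : g.Site, T (b₁.cut y'' μ) := by
    have hμ' : ∑ y'' : g.Site, b₁.cut y'' μ = μ := b₁.sum_cut μ
    conv_lhs => rw [← hμ']
    rw [map_sum]
  -- the pieces outside the class contribute nothing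
  have hzero : ∀ y'' : g.Site, ¬ Rel y'' y' → b₂.loc y (T (b₁.cut y'' μ)) = 0 := fun y'' hy'' => by
    rw [hvanish y' μ hμ y'' hy'', map_zero, b₂.loc_zero]
  have hloc0 : 0 ≤ b₁'.loc y' μ := b₁'.loc_nonneg y' μ
  calc b₂.loc y (T μ) ≤ ∑ y'' : g.Site, b₂.loc y (T (b₁.cut y'' μ)) := by
        rw [hsplit]; exact b₂.loc_sum_le y _ _
    _ = ∑ y'' ∈ Finset.univ.filter (fun y'' => Rel y'' y'), b₂.loc y (T (b₁.cut y'' μ)) := by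
        rw [Finset.sum_filter]
        exact Finset.sum_congr rfl fun y'' _ => by
          by_cases hy : Rel y'' y'
          · rw [if_pos hy]
          · rw [if_neg hy, hzero y'' hy]
    _ ≤ ∑ y'' ∈ Finset.univ.filter (fun y'' => Rel y'' y'), K y y' * b₁'.loc y' μ := by
        refine Finset.sum_le_sum fun y'' hy'' => ?_
        have hy : Rel y'' y' := (Finset.mem_filter.mp hy'').2
        exact (h y'' (b₁.cut y'' μ) (b₁.isLoc_cut y'' μ) y).trans
          (mul_le_mul (hKrel y y' y'' hy) (hle y' μ hμ y'' hy) (b₁.loc_nonneg _ _) (hK y y'))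
    _ = ((Finset.univ.filter (fun y'' => Rel y'' y')).card : ℝ) * (K y y' * b₁'.loc y' μ) := by
        rw [Finset.sum_const, nsmul_eq_mul]
    _ ≤ m * (K y y' * b₁'.loc y' μ) := mul_le_mul_of_nonneg_right (hmult y') (mul_nonneg (hK y y') hloc0)
    _ = m * K y y' * b₁'.loc y' μ := by ring

/-- ★ the same with a kernel CONSTANT on classes (the carrier distance of a `Rel`-class is one number: `dist_eq_of_relB`).
[cite: Balaban1984PropagatorsII, (2.51)–(2.52) p.232, (2.45) p.231] -/
theorem hasMaj_of_dom_classes_eq {b₁ b₁' : BlockNorm g F₁} {b₂ : BlockNorm g F₂} {T : F₁ →ₗ[ℝ] F₂} {K : g.Site → g.Site → ℝ}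
    (Rel : g.Site → g.Site → Prop) [DecidableRel Rel] {m : ℝ}
    (hvanish : ∀ (y' : g.Site) (μ : F₁), b₁'.IsLoc y' μ → ∀ y'' : g.Site, ¬ Rel y'' y' → b₁.cut y'' μ = 0)
    (hle : ∀ (y' : g.Site) (μ : F₁), b₁'.IsLoc y' μ → ∀ y'' : g.Site, Rel y'' y' → b₁.loc y'' (b₁.cut y'' μ) ≤ b₁'.loc y' μ)
    (hK : ∀ a b, 0 ≤ K a b) (hKrel : ∀ a b b', Rel b' b → K a b' = K a b)
    (hmult : ∀ y' : g.Site, ((Finset.univ.filter (fun y'' => Rel y'' y')).card : ℝ) ≤ m)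
    (h : HasMaj b₁ b₂ T K) : HasMaj b₁' b₂ T (fun a b => m * K a b) :=
  hasMaj_of_dom_classes Rel hvanish hle hK (fun a b b' hb => (hKrel a b b' hb).le) hmult h

/-! ## §2 (v1.1, dag-n06-d g21) The transfer with a kernel SLACK on the classes — for class relations that are NOT equivalence classes of the
carrier (print's enlarged cubes `Δ̃(y′)` of the TRANSPORTED input class (3.40): a block near `y′` is at carrier distance `≤ r` of `y′`, so the exponential
kernel changes by at most `e^{δ r}` inside a class — the two-kernel form below, [4] (2.45)–(2.46) p. 231 with (2.52) p. 232). -/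

/-- ★★ **CLASS-MULTIPLICITY TRANSFER WITH KERNEL SLACK**: as `hasMaj_of_dom_classes`, but the kernel may GROW inside a class up to a second kernel
`K′` (`Rel b′ b → K a b′ ≤ K′ a b`); conclusion `HasMaj b₁′ b₂ T (m·K′)`. [cite: Balaban1984PropagatorsII, (2.51)–(2.52) p.232, (2.45)–(2.46) p.231; Balaban1985BackgroundPropagators, (3.40) p.397 + (3.44) p.398] -/
theorem hasMaj_of_dom_classes_le {b₁ b₁' : BlockNorm g F₁} {b₂ : BlockNorm g F₂} {T : F₁ →ₗ[ℝ] F₂} {K K' : g.Site → g.Site → ℝ}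
    (Rel : g.Site → g.Site → Prop) [DecidableRel Rel] {m : ℝ}
    (hvanish : ∀ (y' : g.Site) (μ : F₁), b₁'.IsLoc y' μ → ∀ y'' : g.Site, ¬ Rel y'' y' → b₁.cut y'' μ = 0)
    (hle : ∀ (y' : g.Site) (μ : F₁), b₁'.IsLoc y' μ → ∀ y'' : g.Site, Rel y'' y' → b₁.loc y'' (b₁.cut y'' μ) ≤ b₁'.loc y' μ)
    (hK' : ∀ a b, 0 ≤ K' a b) (hKrel : ∀ a b b', Rel b' b → K a b' ≤ K' a b)
    (hmult : ∀ y' : g.Site, ((Finset.univ.filter (fun y'' => Rel y'' y')).card : ℝ) ≤ m)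
    (h : HasMaj b₁ b₂ T K) : HasMaj b₁' b₂ T (fun a b => m * K' a b) := by
  classical
  intro y' μ hμ y
  have hsplit : T μ = ∑ y'' : g.Site, T (b₁.cut y'' μ) := by
    have hμ' : ∑ y'' : g.Site, b₁.cut y'' μ = μ := b₁.sum_cut μ
    conv_lhs => rw [← hμ']
    rw [map_sum]
  have hzero : ∀ y'' : g.Site, ¬ Rel y'' y' → b₂.loc y (T (b₁.cut y'' μ)) = 0 := fun y'' hy'' => by
    rw [hvanish y' μ hμ y'' hy'', map_zero, b₂.loc_zero]
  have hloc0 : 0 ≤ b₁'.loc y' μ := b₁'.loc_nonneg y' μ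
  calc b₂.loc y (T μ) ≤ ∑ y'' : g.Site, b₂.loc y (T (b₁.cut y'' μ)) := by
        rw [hsplit]; exact b₂.loc_sum_le y _ _
    _ = ∑ y'' ∈ Finset.univ.filter (fun y'' => Rel y'' y'), b₂.loc y (T (b₁.cut y'' μ)) := by
        rw [Finset.sum_filter]
        exact Finset.sum_congr rfl fun y'' _ => by
          by_cases hy : Rel y'' y'
          · rw [if_pos hy]
          · rw [if_neg hy, hzero y'' hy]
    _ ≤ ∑ y'' ∈ Finset.univ.filter (fun y'' => Rel y'' y'), K' y y' * b₁'.loc y' μ := by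
        refine Finset.sum_le_sum fun y'' hy'' => ?_
        have hy : Rel y'' y' := (Finset.mem_filter.mp hy'').2
        exact (h y'' (b₁.cut y'' μ) (b₁.isLoc_cut y'' μ) y).trans
          (mul_le_mul (hKrel y y' y'' hy) (hle y' μ hμ y'' hy) (b₁.loc_nonneg _ _) (hK' y y'))
    _ = ((Finset.univ.filter (fun y'' => Rel y'' y')).card : ℝ) * (K' y y' * b₁'.loc y' μ) := by
        rw [Finset.sum_const, nsmul_eq_mul]
    _ ≤ m * (K' y y' * b₁'.loc y' μ) := mul_le_mul_of_nonneg_right (hmult y') (mul_nonneg (hK' y y') hloc0)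
    _ = m * K' y y' * b₁'.loc y' μ := by ring

/-- ★ the exponential-kernel instance: inside a class the carrier distance to the class centre drops by at most `r` (`Rel b′ b → d(a,b) ≤ d(a,b′) + r`), so
`C·e^{−δ d(a,b′)} ≤ C·e^{δ r}·e^{−δ d(a,b)}`. [cite: Balaban1984PropagatorsII, (2.45)–(2.46) p.231, (2.52) p.232] -/
theorem hasMaj_of_dom_classes_exp {b₁ b₁' : BlockNorm g F₁} {b₂ : BlockNorm g F₂} {T : F₁ →ₗ[ℝ] F₂} (dist : g.Site → g.Site → ℝ) {C δ r : ℝ}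
    (Rel : g.Site → g.Site → Prop) [DecidableRel Rel] {m : ℝ} (hC : 0 ≤ C) (hδ : 0 ≤ δ)
    (hvanish : ∀ (y' : g.Site) (μ : F₁), b₁'.IsLoc y' μ → ∀ y'' : g.Site, ¬ Rel y'' y' → b₁.cut y'' μ = 0)
    (hle : ∀ (y' : g.Site) (μ : F₁), b₁'.IsLoc y' μ → ∀ y'' : g.Site, Rel y'' y' → b₁.loc y'' (b₁.cut y'' μ) ≤ b₁'.loc y' μ)
    (hdist : ∀ a b b', Rel b' b → dist a b ≤ dist a b' + r)
    (hmult : ∀ y' : g.Site, ((Finset.univ.filter (fun y'' => Rel y'' y')).card : ℝ) ≤ m)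
    (h : HasMaj b₁ b₂ T (fun a b => C * Real.exp (-(δ * dist a b)))) :
    HasMaj b₁' b₂ T (fun a b => m * (C * Real.exp (δ * r) * Real.exp (-(δ * dist a b)))) :=
  hasMaj_of_dom_classes_le Rel hvanish hle (fun a b => by positivity)
    (fun a b b' hb => by
      rw [mul_assoc, ← Real.exp_add]
      exact mul_le_mul_of_nonneg_left (Real.exp_le_exp.mpr (by nlinarith [hdist a b b' hb])) hC)
    hmult h

end Literature.MathematicalPhysics.QuantumFieldTheory.Balaban1983to89.B9BlockNormClassTransfer
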